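import Mathlib
import Summits.KontsevichZagierPeriods.Zeta5Search.TwoTaleOmega.OmegaStepBL

/-!
# (bmiss)@Ω — PILOT INSTANCE b/L: the four-term relations of the first-tale functionals along `δ_b`

HONEST FRAMING: systematic search; no irrationality claim unless certified. Pure finite algebra over `ℚ`; no named
fact, no `sorry`.

`OmegaStepBL.dataStep_bL` fed to the generic recurrences of `FormalBarnesStep`:

* `lam1_rec_bL` / `lam0_rec_bL` — the four-term relations for `Λ¹`, `Λ⁰` of `vL(p + kδ_b)` at nodes `s + n_k`, with
  the formal residues ("crossing terms") explicit;
* `rho1_vL_eq_zero`, `rho1_GbL_eq_zero` — the `Λ¹`-residues vanish at every node left of the poles, so in the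
  CONSTANT-NODE case the `ζ(2)`-parts satisfy the clean relation `Σ_k c_k(p) Λ¹_s[vL(p+kδ_b)] = 0` (`lam1_rec_bL_const`);
* `lam0_rec_bL_const` — the same for `Λ⁰` GIVEN the legitimacy input `ρ⁰_s(GbL p) = 0` (blueprint F11: a double zero
  of `Cert_L·F_L` at the node, to be discharged with `PF.rho0_eq_zero_of_sq_mul`);
* degree bookkeeping `PF.natDegree_mulLin_le`, `natDegree_GbL_le`, `dExp_addB_le`.
-/

open Finset Polynomial
open Literature.NumberTheory.Irrationality.Zudilin2014
open Summit.KontsevichZagierPeriods.Zeta5Search.FormalBarnes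

namespace Summit.KontsevichZagierPeriods.Zeta5Search.FormalBarnes.PF

/-- `mulLin` raises the degree of the polynomial part by at most one. -/
theorem natDegree_mulLin_le (c : ℤ) (v : PF) : (v.mulLin c).poly.natDegree ≤ v.poly.natDegree + 1 := by
  show (v.poly * (X + C (c : ℚ)) + C _).natDegree ≤ _
  refine (natDegree_add_le _ _).trans (max_le (natDegree_mul_le.trans ?_) (by simp))
  rw [natDegree_X_add_C]

end Summit.KontsevichZagierPeriods.Zeta5Search.FormalBarnes.PF

namespace Summit.KontsevichZagierPeriods.Zeta5Search.TwoTaleOmega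

namespace Pt

variable (p : Pt)

/-! ### Degree and pole bookkeeping along `δ_b` -/

/-- `deg (GbL p).poly ≤ deg (vL p).poly + 4`. -/
theorem natDegree_GbL_le : p.GbL.poly.natDegree ≤ p.vL.poly.natDegree + 4 := by
  have h1 := PF.natDegree_mulLin_le 0 p.vL
  have h2 := PF.natDegree_mulLin_le (p.a - p.e) (p.vL.mulLin 0)
  have h3 := PF.natDegree_mulLin_le (p.a - p.f) ((p.vL.mulLin 0).mulLin (p.a - p.e))
  have h4 := PF.natDegree_mulLin_le (p.g - 1) (((p.vL.mulLin 0).mulLin (p.a - p.e)).mulLin (p.a - p.f))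
  unfold GbL; omega

/-- Along `δ_b` the exponent `d` grows by at most `k`: `dExp(p + kδ_b) ≤ dExp(p) + k`. -/
theorem dExp_addB_le (k : ℕ) : dExp (p.addB k).t1a (p.addB k).t1b ≤ dExp p.t1a p.t1b + k := by
  unfold dExp
  rw [sum_t1a, sum_t1b, sum_t1a, sum_t1b]
  simp only [addB]
  omega

/-- `a₄*` written out for the hinge. -/
theorem amax_t1a (q : Pt) : amax q.t1a = max (max q.e q.f) (max q.b q.a) := rfl

/-- `a₄*` does not decrease along `δ_b`. -/
theorem amax_le_amax_addB (k : ℕ) : amax p.t1a ≤ amax (p.addB k).t1a := by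
  rw [amax_t1a, amax_t1a]; simp only [addB]; omega

/-- `Λ¹`-residues of `vL q` vanish at nodes `s` with `−s < a₄*` (left of all poles). -/
theorem rho1_vL_eq_zero (q : Pt) {s : ℤ} (hs : -s < amax q.t1a) : rho1 s q.vL = 0 :=
  PF.rho1_eq_zero_of_notMem fun h => by have := (mem_Ico.1 (q.poles_vL h)).1; omega

/-- `Λ¹`-residue of `GbL p` vanishes at nodes `s` with `−s < a₄*`. -/
theorem rho1_GbL_eq_zero {s : ℤ} (hs : -s < amax p.t1a) : rho1 s p.GbL = 0 :=
  PF.rho1_eq_zero_of_notMem fun h => by have := (mem_Ico.1 (p.poles_vL (p.poles_GbL h))).1; omega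

/-! ### The four-term relations -/

/-- **`Λ¹` along `δ_b` (general nodes).** -/
theorem lam1_rec_bL (hadm : ∀ k : Fin 4, Admissible (p.addB ((k : ℕ) : ℤ)).t1a (p.addB ((k : ℕ) : ℤ)).t1b)
    (s : ℤ) (n : Fin 4 → ℕ) :
    ∑ k : Fin 4, p.cB k * lam1 (s + n k) (p.addB ((k : ℕ) : ℤ)).vL
      = rho1 s p.GbL + ∑ k : Fin 4, p.cB k * ∑ i ∈ range (n k), rho1 (s + i) (p.addB ((k : ℕ) : ℤ)).vL :=
  lam1_recurrence s p.cB (fun k : Fin 4 => (p.addB ((k : ℕ) : ℤ)).vL) p.GbL n (p.dataStep_bL hadm)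

/-- **`Λ⁰` along `δ_b` (general nodes)**, with the uniform truncation `d = dExp(p) + 4`. -/
theorem lam0_rec_bL (hadm : ∀ k : Fin 4, Admissible (p.addB ((k : ℕ) : ℤ)).t1a (p.addB ((k : ℕ) : ℤ)).t1b)
    (s : ℤ) (n : Fin 4 → ℕ) :
    ∑ k : Fin 4, p.cB k * lam0 (dExp p.t1a p.t1b + 4) (s + n k) (p.addB ((k : ℕ) : ℤ)).vL
      = rho0 s p.GbL + ∑ k : Fin 4, p.cB k * ∑ i ∈ range (n k), rho0 (s + i) (p.addB ((k : ℕ) : ℤ)).vL := by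
  have hadm0 : Admissible p.t1a p.t1b := by simpa [addB_zero] using hadm 0
  refine lam0_recurrence _ s p.cB (fun k : Fin 4 => (p.addB ((k : ℕ) : ℤ)).vL) p.GbL n (p.dataStep_bL hadm)
    ((p.natDegree_GbL_le).trans (by have := p.vL_natDegree_le hadm0; omega)) fun k => ?_
  have h1 := (p.addB ((k : ℕ) : ℤ)).vL_natDegree_le (hadm k)
  have h2 := p.dExp_addB_le (k : ℕ)
  have h3 : (k : ℕ) ≤ 3 := Nat.lt_succ_iff.1 k.isLt
  exact h1.trans (h2.trans (by omega))

/-- **Constant-node `Λ¹` relation**: at a node `s` left of all poles, `Σ_k c_k(p) Λ¹_s[vL(p+kδ_b)] = 0`. -/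
theorem lam1_rec_bL_const (hadm : ∀ k : Fin 4, Admissible (p.addB ((k : ℕ) : ℤ)).t1a (p.addB ((k : ℕ) : ℤ)).t1b)
    {s : ℤ} (hs : -s < amax p.t1a) :
    ∑ k : Fin 4, p.cB k * lam1 s (p.addB ((k : ℕ) : ℤ)).vL = 0 := by
  have h := lam1_recurrence_zero s p.cB (fun k : Fin 4 => (p.addB ((k : ℕ) : ℤ)).vL) p.GbL (fun _ => 0)
    (p.dataStep_bL hadm) (by simp [p.rho1_GbL_eq_zero hs])
  simpa using h

/-- **Constant-node `Λ⁰` relation given legitimacy**: if `ρ⁰_s(GbL p) = 0` (double zero of `Cert_L·F_L` at the node),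
then `Σ_k c_k(p) Λ⁰_s[vL(p+kδ_b)] = 0`. -/
theorem lam0_rec_bL_const (hadm : ∀ k : Fin 4, Admissible (p.addB ((k : ℕ) : ℤ)).t1a (p.addB ((k : ℕ) : ℤ)).t1b)
    (s : ℤ) (hρ : rho0 s p.GbL = 0) :
    ∑ k : Fin 4, p.cB k * lam0 (dExp p.t1a p.t1b + 4) s (p.addB ((k : ℕ) : ℤ)).vL = 0 := by
  have h := p.lam0_rec_bL hadm s (fun _ => 0)
  simpa [hρ] using h

end Pt

end Summit.KontsevichZagierPeriods.Zeta5Search.TwoTaleOmega
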